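import Summits.BirchSwinnertonDyer.Rank1Residual.GaloisImage.ContinuousH1CoefficientTransport
import Summits.BirchSwinnertonDyer.Rank1Residual.GaloisImage.KolyvaginEulerFactorOperatorRat
import Literature.NumberTheory.GaloisCohomology.FiniteSingularComparison
import Literature.NumberTheory.GaloisRepresentations.DecompositionGroupOfCompletion
import Literature.NumberTheory.GaloisRepresentations.ArtinLFunctionDirichletProofs
import Literature.NumberTheory.EllipticCurves.DeligneSerreWeightOneIrreducibleFrobeniusProofs
import HarnessLib

/-!
# Preliminaries for the finite–singular relation of the ES-derived classes in `H¹(ℚ, E[m])`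
# (cell `b2b-bsdres`, n1011 p11 GEN 10; row T-DER, file C5b-β′; consumed by
# `KolyvaginFiniteSingularTorsion`)

HONEST FRAMING (cell `b2b-bsdres`, run/shared/lean/b2b/bsd-rank1-residual/, verbatim in every
file): the goal of the cell is to DELETE the COMBINATION-SHAPED residual classes of the
Birch–Swinnerton-Dyer formula for ALL analytic-rank `≤ 1` elliptic curves over `ℚ` — "full BSD
formula for every rank `≤ 1` curve in class `C`" assembled STRICTLY from published theorems — so
that the rank-`≤ 1` remainder becomes exactly the CONSTRUCTION-SHAPED classes, which are TYPED
(missing-input `Prop`s), NOT attempted. This is not "finishing BSD". Team n1011: research route on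
the CONSTRUCTION-SHAPED class X4 / §I N11 (route-1 PORT, (P-DER)); TOOL theorems: NO Euler system
is asserted to exist (it is the hypothesis `hc`), no definition, no named fact, no `sorry`.

## What

Four independent TOOL lemmas used by the `fs_rel` assembly `KolyvaginFiniteSingularTorsion`:
* §1 `CoeffTransport.resSubgroup_symm_eq_noncommProd_deriv` — the derivative characterisation
  `res_U κ = D_r (Φ_U x)` pulls back along a GZ-1 coefficient transport `Φ₀ : H¹(G, X) ≃ H¹(G, Y)`
  computed on cocycles by an additive equivariant bijection `e` (the uniqueness branch of GZ-2
  `TorsionCoeff.Rat.exists_sigma_existsUnique_res_eq_deriv_torsionGaloisModule`, isolated);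
* §2 `Derivative.Rat.aeval_rubinEulerFactor_apply_eq_zero_of_isKolyvaginPrime` — THEOREM C's binder
  `hPX`: `P_q(ρ_{T′}(φ⁻¹)) = 0` on any `p^n`-torsion quotient `T′` of `T_pE` at a Kolyvagin prime
  `q` of level `n` (`P_q(Fr⁻¹) = (q − 1)·Z` on `T_pE`, K4/E3a, and `p^n ∣ q − 1`); and
  `smul_eq_val_toZModPow_smul` — on a `ℤ_p`-module killed by `p^n` scalars act through `ℤ/p^n`;
* §3 `CyclotomicLevel.Rat.exists_mem_inertia_modNCyclotomicCharacter_absNorm_eq` /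
  `exists_mem_absInertia_localNormCyclotomicCharacter_eq` — inertia elements at `q` (global at
  `𝔔 ∣ q`, and LOCAL in `Γ_{ℚ_q}`) with prescribed character mod `Nq = absNorm q` (the currency of
  `KolyvaginDatum.HasCanonicalComparison`; C5a's binder `hτ₀`): `ℚ(μ_q)/ℚ` is totally ramified at
  `q`, `I_{𝔓₀} = res(I_{ℚ_q})`.
0 defs, 0 facts.  References: K. Rubin, *Euler Systems* (2000), Def. 4.4.1, Thm. 4.5.4 (proof);
C.-H. Kim, arXiv:2203.12159, §1.2.2; J. Neukirch, *Algebraic Number Theory*, Ch. I §10, Ch. II (9.6).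
-/

noncomputable section

open CategoryTheory Function Finset Polynomial Field IsDedekindDomain
open scoped NumberField
open Literature.NumberTheory.GaloisRepresentations Literature.NumberTheory.EllipticCurves
open Literature.NumberTheory.GaloisRepresentations.IsNonarchimedeanLocalField
open Literature.NumberTheory.GaloisCohomology
open Rat.HeightOneSpectrum

universe u v w

/-! ## §1 Pulling a derivative characterisation back along the coefficient transport -/

namespace Summit.BirchSwinnertonDyer.Rank1Residual.GaloisImage.CoeffTransport

variable {R : Type u} [Ring R] [TopologicalSpace R] {S : Type u} [Ring S] [TopologicalSpace S]
variable {G : Type v} [Group G] [TopologicalSpace G] [IsTopologicalGroup G]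
variable (X : TopRep.{v} R G) (Y : TopRep.{v} S G)
  (e : X →+ Y) (hec : Continuous e) (he : ∀ (g : G) (x : X), e (X.ρ g x) = Y.ρ g (e x))
  (einv : Y →+ X) (h₁ : ∀ x, einv (e x) = x) (h₂ : ∀ y, e (einv y) = y)

include hec he h₁ h₂ in
/-- **The derivative characterisation pulls back along the transport.**  If `Φ₀ : H¹(G, X) ≃ H¹(G, Y)`
and `Φ_U : H¹(U, X) → H¹(U, Y)` are computed on cocycles by the additive equivariant bijection `e`,
and `κ ∈ H¹(G, Y)` restricts on `U` to `D_r (Φ_U x)` (`D_r = ∏_{ℓ∈r} Σ_{j<N_ℓ} j σ_ℓ^j` over `S`),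
then `Φ₀⁻¹ κ` restricts to `D_r x` (over `R`) — the uniqueness branch of GZ-2
`TorsionCoeff.Rat.exists_sigma_existsUnique_res_eq_deriv_torsionGaloisModule`, isolated.
[cite: Rubin2000, Def. 4.4.1] -/
theorem resSubgroup_symm_eq_noncommProd_deriv {ι : Type w} (U : Subgroup G) [U.Normal]
    (Φ₀ : continuousCohomology 1 X ≃+ continuousCohomology 1 Y)
    (hΦ₀ : ∀ (φ : contOneCocycles X) (ψ : contOneCocycles Y), (∀ g, ψ.1 g = e (φ.1 g)) →
      Φ₀ (oneCocycleClass X φ) = oneCocycleClass Y ψ)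
    (Φ : continuousCohomology 1 (subgroupRep X U) →+ continuousCohomology 1 (subgroupRep Y U))
    (hΦ : ∀ (φ : contOneCocycles (subgroupRep X U)) (ψ : contOneCocycles (subgroupRep Y U)),
      (∀ g, ψ.1 g = e (φ.1 g)) → Φ (oneCocycleClass _ φ) = oneCocycleClass _ ψ)
    (σ : ι → G) (N : ι → ℕ) (r : Finset ι) (comm) (comm')
    (x : continuousCohomology 1 (subgroupRep X U)) (κ : continuousCohomology 1 Y)
    (hκ : resSubgroup Y U 1 κ =
      (r.noncommProd (fun ℓ => ∑ j ∈ Finset.range (N ℓ),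
        (j : Module.End S (continuousCohomology 1 (subgroupRep Y U))) *
          (conjMap Y U (σ ℓ) 1).hom.toLinearMap ^ j) comm') (Φ x)) :
    resSubgroup X U 1 (Φ₀.symm κ) =
      (r.noncommProd (fun ℓ => ∑ j ∈ Finset.range (N ℓ),
        (j : Module.End R (continuousCohomology 1 (subgroupRep X U))) *
          (conjMap X U (σ ℓ) 1).hom.toLinearMap ^ j) comm) x := by
  apply injective_of_oneCocycleClass (subgroupRep X U) (subgroupRep Y U) e (fun g x => he g x)
    einv h₁ h₂ Φ hΦ hec
  rw [comm_noncommProd_deriv_conjMap X Y e U σ N r Φ hΦ hec he comm comm',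
    comm_resSubgroup X Y e U Φ₀.toAddMonoidHom (fun φ ψ h => hΦ₀ φ ψ h) Φ hΦ hec he (Φ₀.symm κ)]
  change resSubgroup Y U 1 (Φ₀ (Φ₀.symm κ)) = _
  rw [AddEquiv.apply_symm_apply]
  exact hκ

end Summit.BirchSwinnertonDyer.Rank1Residual.GaloisImage.CoeffTransport

/-! ## §2 `P_q(ρ_{T′}(Fr⁻¹)) = 0` on a `p^n`-torsion quotient of `T_pE`; scalars through `ℤ/p^n` -/

namespace Summit.BirchSwinnertonDyer.Rank1Residual.GaloisImage.Derivative.Rat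

variable (W : WeierstrassCurve ℚ) [W.IsElliptic] [W.IsGloballyMinimal] (p : ℕ) [Fact p.Prime]
variable [Module.Free ℤ_[p] (W.tateModule p)] [Module.Finite ℤ_[p] (W.tateModule p)]
  [ContinuousSMul ℤ_[p] (W.tateModule p)]

/-- Local notation: `T∞ = T_p E` as a continuous `G_ℚ`-representation. -/
local notation3 "T∞" => WeierstrassCurve.tateGaloisRep W p (W.continuous_galoisRepTate_holds p)

/-- Local notation: `𝐏⟦φ⟧ = P(φ⁻¹ | T_pE^*; X)`, Rubin's Euler factor. -/
local notation3 "𝐏⟦" φ "⟧" =>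
  rubinEulerFactor (WeierstrassCurve.galoisRepTate W p) (cyclotomicCharacterToUnits ℚ p ℤ_[p]) φ

/-- **`P_q(ρ_{T′}(φ⁻¹)) = 0` on any `p^n`-torsion quotient of `T_pE` at a Kolyvagin prime of level
`n`**: on `T_pE`, `P_q(Fr⁻¹) = (q − 1)·Z_{Fr}` (K4 / E3a
`CyclotomicLevel.Rat.aeval_galoisRepTate_inv_rubinEulerFactor_apply`), `red` is onto and
intertwines, and `p^n ∣ q − 1` kills `T′` — THEOREM C's binder `hPX`.
[cite: Rubin2000, Thm. 4.5.4 (proof)] [cite: Kim2022StructureSelmer, §1.2.2] -/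
theorem aeval_rubinEulerFactor_apply_eq_zero_of_isKolyvaginPrime
    {M' : Type} [AddCommGroup M'] [Module ℤ_[p] M'] [TopologicalSpace M'] [IsTopologicalAddGroup M']
    [ContinuousSMul ℤ_[p] M'] {T' : GaloisRep ℚ ℤ_[p] M'} (red : T∞.toTopRep ⟶ T'.toTopRep)
    (hred : Function.Surjective red.hom) {n : ℕ} (hM : ∀ m : M', ((p : ℤ_[p]) ^ n) • m = 0)
    {q : HeightOneSpectrum (𝓞 ℚ)} (hKol : Kato.IsKolyvaginPrime W p n ((primesEquiv q : Nat.Primes) : ℕ))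
    {φ : absoluteGaloisGroup ℚ} (hφ : IsArithFrobAtPlace ℚ q φ) (w : M') :
    aeval ((T'.toTopRep.ρ φ⁻¹ : M' →L[ℤ_[p]] M') : Module.End ℤ_[p] M') 𝐏⟦φ⟧ w = 0 := by
  have hgood : W.HasGoodReductionAt q := CyclotomicLevel.Rat.hasGoodReductionAt_of_isKolyvaginPrime W hKol
  obtain ⟨u, -, hZ⟩ :=
    CyclotomicLevel.Rat.aeval_galoisRepTate_inv_rubinEulerFactor_apply W p hKol.ne hgood hφ
  obtain ⟨t, rfl⟩ := hred w
  have hcomm : ∀ v : W.tateModule p,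
      red.hom.toLinearMap ((W.galoisRepTate p φ⁻¹ : Module.End ℤ_[p] (W.tateModule p)) v) =
        ((T'.toTopRep.ρ φ⁻¹ : M' →L[ℤ_[p]] M') : Module.End ℤ_[p] M') (red.hom.toLinearMap v) :=
    fun v => TopRep.hom_comm_apply red φ⁻¹ v
  have h : red.hom (aeval (W.galoisRepTate p φ⁻¹) 𝐏⟦φ⟧ t) =
      aeval ((T'.toTopRep.ρ φ⁻¹ : M' →L[ℤ_[p]] M') : Module.End ℤ_[p] M') 𝐏⟦φ⟧ (red.hom t) :=
    apply_aeval_apply_eq_of_comm red.hom.toLinearMap hcomm 𝐏⟦φ⟧ t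
  rw [← h, hZ t, LinearMap.smul_apply, map_smul]
  -- `p^n ∣ q − 1`
  obtain ⟨d, hd⟩ := (Nat.modEq_iff_dvd' hKol.prime.one_lt.le).mp hKol.modEq_one.symm
  rw [hd, Nat.cast_mul, mul_comm, mul_smul, Nat.cast_pow, hM, smul_zero]

omit [W.IsElliptic] [W.IsGloballyMinimal] [Module.Free ℤ_[p] (W.tateModule p)]
  [Module.Finite ℤ_[p] (W.tateModule p)] [ContinuousSMul ℤ_[p] (W.tateModule p)] in
/-- On a `ℤ_p`-module killed by `p^n`, a scalar acts through its residue mod `p^n`: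
`r • z = (r mod p^n).val • z` (`r − (r mod p^n).val ∈ p^n ℤ_p`, Mathlib `PadicInt.ker_toZModPow`) —
the scalar-compatibility binder `hg` of n1011-p13's
`TorsionComparison.map_aeval_eq_comparisonOp_of_isKolyvaginPrime` for any additive `g`. [folklore] -/
theorem smul_eq_val_toZModPow_smul {M' : Type*} [AddCommGroup M'] [Module ℤ_[p] M'] {n : ℕ}
    (hM : ∀ m : M', ((p : ℤ_[p]) ^ n) • m = 0) (r : ℤ_[p]) (z : M') :
    r • z = (PadicInt.toZModPow n r).val • z := by
  have hker : r - ((PadicInt.toZModPow n r).val : ℤ_[p]) ∈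
      RingHom.ker (PadicInt.toZModPow n : ℤ_[p] →+* ZMod (p ^ n)) := by
    rw [RingHom.mem_ker, map_sub, map_natCast, ZMod.natCast_zmod_val, sub_self]
  rw [PadicInt.ker_toZModPow, Ideal.mem_span_singleton] at hker
  obtain ⟨s, hs⟩ := hker
  have h : r = ((PadicInt.toZModPow n r).val : ℤ_[p]) + (p : ℤ_[p]) ^ n * s := by
    rw [← hs, add_sub_cancel]
  calc r • z = (((PadicInt.toZModPow n r).val : ℤ_[p]) + (p : ℤ_[p]) ^ n * s) • z := by rw [← h]
    _ = (PadicInt.toZModPow n r).val • z := by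
      rw [add_smul, Nat.cast_smul_eq_nsmul, mul_comm, mul_smul, hM, smul_zero, add_zero]

end Summit.BirchSwinnertonDyer.Rank1Residual.GaloisImage.Derivative.Rat

/-! ## §3 Inertia elements at `q` with prescribed character mod `Nq = absNorm q` -/

namespace Summit.BirchSwinnertonDyer.Rank1Residual.GaloisImage.CyclotomicLevel.Rat

/-- **An inertia element at `q` with prescribed mod-`Nq` cyclotomic character** (`Nq = absNorm q`,
the currency of `KolyvaginDatum.HasCanonicalComparison`; over `ℚ`, `Nq = q′` is prime and
`ℚ(μ_{q′})/ℚ` is totally ramified at `q′`). [folklore] -/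
theorem exists_mem_inertia_modNCyclotomicCharacter_absNorm_eq (q : HeightOneSpectrum (𝓞 ℚ))
    {𝔔 : Ideal (absIntegers (𝓞 ℚ) ℚ)} (h𝔔 : 𝔔 ∈ q.primesAbove)
    (a : (ZMod (Ideal.absNorm q.asIdeal))ˣ) :
    ∃ τ ∈ 𝔔.inertia (absoluteGaloisGroup ℚ),
      modNCyclotomicCharacter ℚ (Ideal.absNorm q.asIdeal) τ = a := by
  haveI : Fact ((primesEquiv q : Nat.Primes) : ℕ).Prime := ⟨(primesEquiv q).2⟩
  have hm : Ideal.absNorm q.asIdeal = ((primesEquiv q : Nat.Primes) : ℕ) ^ (0 + 1) * 1 := by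
    rw [zero_add, pow_one, mul_one]; exact Literature.NumberTheory.LFunctions.absNorm_asIdeal_eq_primesEquiv q
  have ha : ZMod.unitsMap (Dvd.intro_left _ hm.symm) a = 1 := Subsingleton.elim _ _
  exact exists_mem_inertia_modNCyclotomicCharacter_eq (v := q) hm (primesEquiv q).2.not_dvd_one
    rfl h𝔔 ha

/-- **A LOCAL inertia element of `ℚ_q` with prescribed character `χ_{Nq}`** — the binder `hτ₀` of
C5a: `I_{𝔓₀} = res(I_{ℚ_q})` (tree `inertia_adicCompletionPrime_eq_map_absInertia`). [folklore] -/
theorem exists_mem_absInertia_localNormCyclotomicCharacter_eq (q : HeightOneSpectrum (𝓞 ℚ))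
    (a : (ZMod (Ideal.absNorm q.asIdeal))ˣ) :
    ∃ τ₀ ∈ absInertia (q.adicCompletion ℚ),
      localNormCyclotomicCharacter q τ₀ = a := by
  obtain ⟨τ, hτI, hτχ⟩ := exists_mem_inertia_modNCyclotomicCharacter_absNorm_eq q
    (adicCompletionPrime_mem_primesAbove ℚ q) a
  rw [inertia_adicCompletionPrime_eq_map_absInertia, Subgroup.mem_map] at hτI
  obtain ⟨τ₀, hτ₀, rfl⟩ := hτI
  exact ⟨τ₀, hτ₀, by rw [localNormCyclotomicCharacter_apply]; exact hτχ⟩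

end Summit.BirchSwinnertonDyer.Rank1Residual.GaloisImage.CyclotomicLevel.Rat

end
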